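import Literature.NumberTheory.LFunctions.MultiplicativeCorrelations
import HarnessLib

/-!
# Barrier catalogue `Parity`: Elliott's conjecture in its original form is false
# (Matomäki–Radziwiłł–Tao 2015, Appendix B) — pointwise non-pretentiousness does not force
# cancellation in binary correlations of multiplicative functions

Catalogue entry (D-0021) for the summit `Parity`, sub-problem `GeneralizedHardyLittlewood`.
The binary (infinite-complexity) case of `Literature.NumberTheory.Sieve.GeneralizedHardyLittlewood` — twin primes,
`∑ Λ(n)Λ(n+2)` — is attacked on the multiplicative side through correlations of bounded
multiplicative functions (Chowla: `Literature.NumberTheory.Sieve.ChowlaConjecture`; Elliott: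
`Literature.NumberTheory.LFunctions.ElliottConjectureMRT`, parity.S24; the tree's `Literature.NumberTheory.LFunctions.tao_log_chowla_two`,
`Literature.NumberTheory.LFunctions.tao_log_averaged_elliott_two`; route `MobiusShiftedPrimes` of this sub-problem). The
natural general statement here is Elliott's conjecture: `∑_{n ≤ X} ∏ⱼ gⱼ(aⱼn + bⱼ) = o(X)` for
`1`-bounded multiplicative `gⱼ` unless every `gⱼ` pretends to be a twisted character
`χ(n)n^{it}`. Matomäki–Radziwiłł–Tao proved that in Elliott's ORIGINAL formulation — the
hypothesis being only `𝔻(g_{j₀}, χ(n)n^{it}; ∞) = ∞` for every fixed `χ` and every fixed real `t`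
(`M(g_{j₀}; ∞, ∞) = ∞`) — the conjecture is FALSE (Theorem B.1): a `1`-bounded multiplicative `g`
can be far from every fixed `χ(n)n^{it}` globally and yet be very close, at each scale `t_{m+1}`,
to some Archimedean character `n^{i s_{m+1}}` with `s_{m+1} → ∞`, which makes
`|∑_{n ≤ t_m} g(n) conj(g(n+1))| ≫ t_m`. The corrected conjecture (their Conjecture 1.5 with
(1.8): `inf_{|t| ≤ X} 𝔻(g_{j₀}, χ(n)n^{it}; X) → ∞` for each fixed `χ` — the tree's
`Literature.NumberTheory.Sieve.IsNonpretentious`) is the form in which every subsequent theorem is stated.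

* `IsPointwiseNonpretentious g` — Elliott's original hypothesis `M(g; ∞, ∞) = ∞`
  (MRT (1.6)), the technique-class parameter of this entry;
* `ElliottConjectureOriginal` — MRT Conjecture 1.5 as printed with hypothesis (1.6): **REFUTED as
  stated** and kept only as a `@[deprecated]` tombstone (verdict clean-up 2026-08-16, below);
* `MatomakiRadziwillTao2015_counterexample` — Theorem B.1 as printed (named fact; docstring =
  BARRIER block);
* PROVED: `IsNonpretentious.isPointwiseNonpretentious` (the corrected hypothesis implies the
  original one, so the original conjecture is the STRONGER statement),
  `ElliottConjectureOriginal.elliottConjectureMRT` (original ⟹ corrected, tree form), and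
  `MatomakiRadziwillTao2015_counterexample.not_elliottConjectureOriginal` (Theorem B.1 refutes
  the original conjecture already for `k = 2`, `(a₁,b₁) = (1,0)`, `(a₂,b₂) = (1,1)`,
  `g₂ = conj ∘ g₁`).

The fact is PROVED in the sibling file `ElliottOriginalFormProofs.lean`
(`MatomakiRadziwillTao2015_counterexample_holds`, `ElliottConjectureOriginal_false`) and its
claimed scope is NARROWED by the 2026-08-16 barrier audit in `ElliottOriginalFormNarrow.lean`:
only ALL-scales conclusions are obstructed — under the original hypothesis two-point correlations
still vanish along a set of scales of full upper logarithmic density (Klurman–Mangerel–Teräväinen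
2023, Theorem 1.2, named fact `KlurmanMangerelTeravainen2023_twoPoint`; `not_counterexample_allScales`
proved from it), and the hypotheses between (1.6) and (1.8) are classified (bounded windows ⟺
(1.6), power windows ⟺ (1.8), both proved); see the AUDIT clauses of `blocks:`,
`evasions_known:` (d)–(e) and `scope_caveats:` below.

Verdict clean-up (2026-08-16, `ElliottConjectureOriginal`). The definition `ElliottConjectureOriginal`
is a faithful transcription of MRT Conjecture 1.5 with hypothesis (1.6) (re-read on the page:
arXiv:1503.05121 p. 4, Conjecture 1.5 and (1.6); p. 14, Theorem B.1 "a counterexample to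
Conjecture 1.5", shifts `n, n + 1`), and that printed statement is FALSE: its negation is the
kernel-checked, unconditional theorem
`Literature.Barriers.Parity.ElliottConjectureOriginal_false : ¬ ElliottConjectureOriginal`
(`ElliottOriginalFormProofs.lean`; axioms `propext`, `Classical.choice`, `Quot.sound`; re-checked
2026-08-16). So no `ElliottConjectureOriginal_holds` can ever exist and the definition is NOT
literature debt: it is kept, statement byte-for-byte, as a `@[deprecated]` tombstone only because its
refutation (`ElliottConjectureOriginal_false`, and `MatomakiRadziwillTao2015_counterexample.not_elliottConjectureOriginal`
below) names it; the two in-file theorems that mention it switch `linter.deprecated` off for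
themselves alone. The statement to USE is the corrected conjecture
`Literature.NumberTheory.LFunctions.ElliottConjectureMRT` (MRT Conjecture 1.5 with (1.8)), or, keeping
the pointwise hypothesis (1.6), the almost-all-scales conclusion of
`KlurmanMangerelTeravainen2023_twoPoint` (`ElliottOriginalFormNarrow.lean`).

## What the sources print (verified on the page; arXiv page numbers)

* Matomäki–Radziwiłł–Tao, *An averaged form of Chowla's conjecture*, Algebra & Number Theory 9
  (2015), arXiv:1503.05121 [cite: MatomakiRadziwillTao2015, §1.1 (1.6)–(1.8), Conjecture 1.5, Appendix B Theorem B.1].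
  p. 4: "`M(g;X) := inf_{|t| ≤ X} 𝔻(g, n ↦ n^{it}; X)²`", "`M(g; X, Q) := inf_{q ≤ Q; χ (q)} M(g χ̄; X)`",
  "`M(g;∞,∞) = inf_{χ, t} 𝔻(g, n ↦ χ(n)n^{it}; ∞)²` where `χ` now ranges over all Dirichlet
  characters and `t` ranges over all real numbers." Conjecture 1.5 (Elliott's conjecture): "Let
  `g₁,…,g_k : ℕ → ℂ` be `1`-bounded multiplicative functions, and let `a₁,…,a_k,b₁,…,b_k` be
  natural numbers such that any two of the `(a₁,b₁),…,(a_k,b_k)` are linearly independent in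
  `ℚ²`. Suppose that there is an index `1 ≤ j₀ ≤ k` such that `M(g_{j₀}; ∞, ∞) = ∞`. Then
  `∑_{1 ≤ n ≤ X} ∏_{j=1}^k g_j(a_j n + b_j) = o(X)` as `X → ∞`." Then: "When one allows the
  functions `g_j` to be complex-valued rather than real-valued, Elliott's conjecture turns out
  to be false on a technicality; one can choose `1`-bounded multiplicative functions `g_j` which
  are arbitrarily close at various scales to a sequence of functions of the form `n ↦ n^{it_m}`
  (which allows one to violate (1.7)) without globally pretending to be `n^{it}` (or `χ(n)n^{it}`)
  for any fixed `t`; we present this counterexample in Appendix B. However, this counterexample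
  can be removed by replacing (1.6) with the stronger condition that `M(g_{j₀}; X, Q) → ∞` as
  `X → ∞` for each fixed `Q`. In the real-valued case, (1.8) and (1.6) are equivalent by a
  triangle inequality argument of Granville and Soundararajan which we give in Appendix C."
  Theorem B.1 (Counterexample): "There exists a `1`-bounded multiplicative function `g : ℕ → ℂ`
  such that `∑_p (1 - Re(g(p) χ̄(p) p^{-it}))/p = ∞` for all Dirichlet characters `χ` and
  `t ∈ ℝ` (i.e., one has `M(g;∞,∞) = ∞`), but such that `|∑_{n ≤ t_m} g(n) ḡ(n+1)| ≫ t_m` for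
  all sufficiently large `m`, and some sequence `t_m` going to infinity." Proof: `g(p) := 1`
  for `p ≤ t₁ = 100`; given `g(p)` for `p ≤ t_m`, by Kronecker equidistribution of
  `t ↦ (p^{it})_{p ≤ t_m}` ("As the quantities `log p` are linearly independent over the
  integers") choose `s_{m+1} > exp(t_m)` with `p^{i s_{m+1}} = g(p)(1 + O(1/t_m²))` for all
  `p ≤ t_m`; set `t_{m+1} := s_{m+1}²`, `g(p) := p^{i s_{m+1}}` for `t_m < p ≤ t_{m+1}`;
  `g(n) := μ(n)² ∏_{p ∣ n} g(p)`. Then `g(n) = n^{i s_{m+1}} + O(1/t_m)` for square-free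
  `n ≤ t_{m+1}`, so `g(n) ḡ(n+1) = μ²(n)μ²(n+1) + O(1/t_m)` for `t_{m+1}^{3/4} ≤ n ≤ t_{m+1} - 1`,
  "and the claim (B.2) then easily follows since the sequence `μ²(n)μ²(n+1)` has positive mean
  value"; the divergence (B.1) for fixed `χ, t` is obtained from the block
  `exp((log t_{m+1})^{5/6}) < p ≤ t_{m+1}` "as in (2.3)" (Vinogradov–Korobov). After the
  proof: "It is easy to see that the function `g` constructed in the above counterexample
  violates (1.8), and so is not a counterexample to the corrected form of Conjecture 1.5. It is
  also not difficult to modify the above counterexample so that the function `g` is completely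
  multiplicative instead of multiplicative …; we leave the details to the interested reader."
* Tao, Forum Math. Pi 4 (2016) e8, arXiv:1509.05422 [cite: TaoFMP2016, Remark 1.6 and Theorem 1.3].
  Remark 1.6: the non-logarithmically-averaged conclusion "(say with `b₁, b₂ ≥ 0` to avoid the
  linear forms `a₁n+b₁, a₂n+b₂` leaving the domain of `g₁, g₂`) … is the `k=2` version of the
  corrected Elliott conjecture introduced in [mrt]. The original Elliott conjecture in [elliott]
  replaced the condition (1.9) with the weaker condition `∑_p (1 - Re g₁(p)χ̄(p)p^{-it})/p = +∞`
  for all real numbers `t ∈ ℝ`, but it was shown in [mrt] that this hypothesis was insufficient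
  to establish (1.10) (and it is not difficult to adapt the counterexample to also show that
  (1.8) [the logarithmically averaged conclusion] fails under this hypothesis)."
* Tao–Teräväinen, Algebra & Number Theory 13 (2019), arXiv:1809.02518
  [cite: TaoTeravainen2019AlmostAllScales, §1 (Conjecture 1.1 discussion) and Corollary 1.13]: "[Elliott], with the
  condition (1.2) weakened to the assertion that `𝔻(g_j, n ↦ χ(n)n^{it}; X) → ∞` for each fixed
  `t`, with no uniformity in `t` assumed. However, it was shown in [mrt] that this version of the
  conjecture fails for a technical reason." Corollary 1.13: the binary unweighted Elliott
  conjecture at almost all scales, under the corrected hypothesis for one of `g₁, g₂`.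

Design. Multiplicative functions are `ArithmeticFunction ℂ` with `IsMultiplicative` and the
pretentious distance `Literature.NumberTheory.Sieve.pretentiousDistSq`, `Literature.NumberTheory.Sieve.twistedChar` of
`Literature/NumberTheory/Sieve/PretentiousDistance.lean`, exactly as in the tree's
`Literature.NumberTheory.LFunctions.ElliottConjectureMRT`; nothing there is restated. MRT's "natural numbers `a_j, b_j`" is
rendered as `a_j ≥ 1`, `b_j ≥ 0` (Tao's Remark 1.6 convention `b₁, b₂ ≥ 0`); the sequence
`t_m → ∞` of Theorem B.1 is a map `T : ℕ → ℕ` tending to infinity (the printed `t_m` are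
reals and the sum is over `n ≤ t_m`; `⌊t_m⌋` serves). Theorem B.1 rests on Kronecker's theorem
for `(log p)_p` and on the Vinogradov–Korobov zero-free region (divergence (B.1)); neither is
in Mathlib, hence a named fact.
-/

noncomputable section

open Filter Asymptotics Finset
open scoped ComplexConjugate

namespace Literature.Barriers.Parity

/-! ## The two non-pretentiousness hypotheses -/

/-- **Elliott's original non-pretentiousness hypothesis** `M(g; ∞, ∞) = ∞` (MRT (1.6)): for
EVERY Dirichlet character `χ` (any modulus `q ≥ 1`) and EVERY fixed real `t`,
`𝔻(g, n ↦ χ(n)n^{it}; ∞)² = ∑_p (1 - Re(g(p) χ̄(p) p^{-it}))/p = ∞`, written as divergence of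
the partial sums `𝔻(g, χ(n)n^{it}; x)² → ∞` (`Literature.NumberTheory.Sieve.pretentiousDistSq`, `Literature.NumberTheory.Sieve.twistedChar`). No
uniformity in `t` — contrast the tree's corrected hypothesis `Literature.NumberTheory.Sieve.IsNonpretentious`
(`inf_{|t| ≤ x} 𝔻(…; x)² → ∞` for each fixed `χ`, MRT (1.8)).
[cite: MatomakiRadziwillTao2015, §1.1 (1.6) and Theorem B.1 (B.1)] -/
def IsPointwiseNonpretentious (g : ℕ → ℂ) : Prop :=
  ∀ (q : ℕ) [NeZero q] (χ : DirichletCharacter ℂ q) (t : ℝ),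
    Tendsto (fun x : ℝ => Literature.NumberTheory.Sieve.pretentiousDistSq g (Literature.NumberTheory.Sieve.twistedChar χ t) x) atTop atTop

/-- **REFUTED as stated — `@[deprecated]` tombstone (verdict clean-up 2026-08-16); kept, statement
byte-for-byte, only because its refutation names it. Not literature debt: no
`ElliottConjectureOriginal_holds` can exist.**
**Elliott's conjecture, ORIGINAL form** (MRT Conjecture 1.5 with hypothesis (1.6), after
Elliott 1992/1994): for `1`-bounded multiplicative `g₁, …, g_k : ℕ → ℂ` and natural numbers
`a_j ≥ 1`, `b_j ≥ 0` with `(a_i, b_i), (a_j, b_j)` pairwise linearly independent in `ℚ²`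
(`a_i b_j ≠ a_j b_i`), if SOME `g_{j₀}` satisfies `M(g_{j₀}; ∞, ∞) = ∞`
(`IsPointwiseNonpretentious`), then `∑_{1 ≤ n ≤ X} ∏ⱼ g_j(a_j n + b_j) = o(X)`.
The transcription is faithful and the PRINTED conjecture is false — the source's own Theorem B.1 is
"a counterexample to Conjecture 1.5" (complex-valued `g`, `k = 2`, `g₂ = ḡ₁`, shifts `n, n + 1`).
**Refutation (kernel-checked, unconditional, kept):**
`Literature.Barriers.Parity.ElliottConjectureOriginal_false : ¬ ElliottConjectureOriginal`
(sibling file `ElliottOriginalFormProofs.lean`: `MatomakiRadziwillTao2015_counterexample_holds` fed to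
`MatomakiRadziwillTao2015_counterexample.not_elliottConjectureOriginal` below). **Use instead:** the
corrected conjecture `Literature.NumberTheory.LFunctions.ElliottConjectureMRT` (MRT Conjecture 1.5 with
(1.8); the original form implies it, `ElliottConjectureOriginal.elliottConjectureMRT`), its proved
logarithmically averaged binary case `Literature.NumberTheory.LFunctions.tao_log_averaged_elliott_two`,
or — keeping the pointwise hypothesis (1.6) — the conclusion along scales of full upper logarithmic
density, `KlurmanMangerelTeravainen2023_twoPoint` (`ElliottOriginalFormNarrow.lean`).
[cite: MatomakiRadziwillTao2015, Conjecture 1.5 with (1.6) and Appendix B, Theorem B.1] -/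
@[deprecated "refuted as stated (Matomäki–Radziwiłł–Tao 2015, Theorem B.1): see \
  Literature.Barriers.Parity.ElliottConjectureOriginal_false (ElliottOriginalFormProofs.lean); \
  corrected statement: Literature.NumberTheory.LFunctions.ElliottConjectureMRT \
  (MRT Conjecture 1.5 with hypothesis (1.8))" (since := "2026-08-16")]
def ElliottConjectureOriginal : Prop :=
  ∀ (k : ℕ) (g : Fin k → ArithmeticFunction ℂ) (a b : Fin k → ℕ),
    (∀ j, (g j).IsMultiplicative) → (∀ j n, ‖g j n‖ ≤ 1) →
    (∀ j, 1 ≤ a j) → (∀ i j, i ≠ j → a i * b j ≠ a j * b i) →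
    (∃ j, IsPointwiseNonpretentious (g j)) →
    (fun X : ℕ => ∑ n ∈ Icc 1 X, ∏ j, g j (a j * n + b j)) =o[atTop] fun X : ℕ => (X : ℂ)

/-! ## The barrier: Theorem B.1 -/

/-- **Matomäki–Radziwiłł–Tao, Theorem B.1 (counterexample to the uncorrected Elliott
conjecture).** There exists a `1`-bounded multiplicative `g : ℕ → ℂ` such that
`∑_p (1 - Re(g(p) χ̄(p) p^{-it}))/p = ∞` for ALL Dirichlet characters `χ` and ALL `t ∈ ℝ`
(`M(g; ∞, ∞) = ∞`, `IsPointwiseNonpretentious g`), but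
`|∑_{n ≤ t_m} g(n) conj(g(n+1))| ≫ t_m` for all sufficiently large `m`, for some sequence
`t_m → ∞`. Named fact (Kronecker equidistribution of `(p^{it})_{p ≤ t_m}` and the
Vinogradov–Korobov zero-free region are used in print and are not in Mathlib).
[cite: MatomakiRadziwillTao2015, Appendix B, Theorem B.1]

BARRIER (D-0021; one line per key):
technique_class: pretentious / multiplicative-function methods for binary correlations whose only hypothesis on the functions is POINTWISE non-pretentiousness `M(g; ∞, ∞) = ∞` — divergence of `𝔻(g_{j₀}, χ(n)n^{it}; x)²` for each fixed `(χ, t)`, no uniformity in `|t| ≤ x` (`IsPointwiseNonpretentious`; the hypothesis (1.6) of Elliott's conjecture as originally formulated) [cite: MatomakiRadziwillTao2015, §1.1 (1.6) and Conjecture 1.5].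
blocks: Elliott's conjecture in its original form `ElliottConjectureOriginal` — the natural common strengthening of Chowla's conjecture (`Literature.NumberTheory.Sieve.ChowlaConjecture`; "Elliott's conjecture implies Chowla's conjecture") and of the corrected `Literature.NumberTheory.LFunctions.ElliottConjectureMRT` (parity.S24; `ElliottConjectureOriginal.elliottConjectureMRT`, proved): it is FALSE for complex-valued functions, already for `k = 2`, `g₂ = ḡ₁`, shifts `(n, n+1)` (`MatomakiRadziwillTao2015_counterexample.not_elliottConjectureOriginal`, proved from the fact) [cite: MatomakiRadziwillTao2015, Conjecture 1.5 and Theorem B.1]; "it is not difficult to adapt the counterexample to also show that" the LOGARITHMICALLY averaged conclusion `∑_{x/ω<n≤x} g₁(a₁n+b₁)g₂(a₂n+b₂)/n = o(log ω)` fails under the original hypothesis, so Tao's two-point theorem (`Literature.NumberTheory.LFunctions.tao_log_averaged_elliott_two`, hypothesis for all `|t| ≤ Ax`) cannot be had under (1.6) either [cite: TaoFMP2016, Remark 1.6 and Theorem 1.3]; consequently no argument deriving `o(X)` (or `o(log)`-averaged) binary correlation bounds for general `1`-bounded multiplicative functions can use less than locally-uniform-in-`t` non-pretentiousness [cite: TaoTeravainen2019AlmostAllScales,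 §1 (discussion of Conjecture 1.1)]; AUDIT (2026-08-16, file `ElliottOriginalFormNarrow.lean`): the last consequence is correct for ALL-SCALES conclusions only — `o(X)` as `X → ∞` through all `X`, through a set of scales of logarithmic density `1`, or even through a set of scales of full upper double-logarithmic density ("the condition `δ⁺_log(𝒳) = 1` cannot be strengthened to `δ_log(𝒳) = 1`, or even to `δ⁺_loglog(𝒳) = 1`": for every `δ > 0` a pointwise non-pretentious `f` with `|∑_{n ≤ x} f(n)f̄(n+1)| ≥ (1 − δ)x` along a set of scales with `δ⁺_loglog = 1`) [cite: KlurmanMangerelTeravainen2023, Proposition 1.3]; it is FALSE for conclusions along a set of scales of full UPPER logarithmic density, which the pointwise hypothesis (1.6) alone DOES deliver for two-point correlations (`KlurmanMangerelTeravainen2023_twoPoint`; hence `not_counterexample_allScales`: no pointwise non-pretentious `g` has `|∑_{n ≤ X} g(n)ḡ(n+1)| ≥ cX` for all large `X`, proved there) [cite: KlurmanMangerelTeravainen2023, Theorem 1.2].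
because: choose `g(p) = p^{i s_{m+1}}` on `t_m < p ≤ t_{m+1} = s_{m+1}²`, where `s_{m+1} > exp(t_m)` is chosen by Kronecker's theorem (the `log p` are ℤ-linearly independent) so that `p^{i s_{m+1}} = g(p)(1 + O(t_m^{-2}))` for all `p ≤ t_m`, and `g(n) = μ²(n) ∏_{p∣n} g(p)`; then `g(n) = n^{i s_{m+1}} + O(1/t_m)` for square-free `n ≤ t_{m+1}`, hence `g(n)ḡ(n+1) = μ²(n)μ²(n+1) + O(1/t_m)` on `t_{m+1}^{3/4} ≤ n < t_{m+1}` and the correlation is `≫ t_{m+1}` because `μ²(n)μ²(n+1)` has positive mean value — `g` is "arbitrarily close at various scales to a sequence of functions of the form `n ↦ n^{it_m}`" — while for each FIXED `(χ, t)` the distance over the primes in `(exp((log t_{m+1})^{5/6}), t_{m+1}]` alone tends to infinity with `m` (as in MRT (2.3), zero-free region), so `M(g;∞,∞) = ∞` [cite: MatomakiRadziwillTao2015, Appendix B (proof of Theorem B.1) and §1.1].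
evasions_known: (a) the corrected hypothesis (1.8) `M(g_{j₀}; X, Q) → ∞` for each fixed `Q` (tree `Literature.NumberTheory.Sieve.IsNonpretentious`; `Literature.NumberTheory.LFunctions.ElliottConjectureMRT`), which the counterexample violates ("so is not a counterexample to the corrected form") [cite: MatomakiRadziwillTao2015, §1.1 (1.8) and Appendix B (last paragraph)]; (b) REAL-valued functions: there (1.6) and (1.8) are equivalent (Granville–Soundararajan triangle-inequality argument), so Chowla's conjecture for `λ` is untouched, and `M(λ; ∞, ∞) = ∞` by the prime number theorem in arithmetic progressions [cite: MatomakiRadziwillTao2015, §1.1 and Appendix C]; (c) averaged forms of the corrected conjecture that are theorems: averaging over the shifts `b_j ≤ H`, `H → ∞` (MRT Theorem 1.6) [cite: MatomakiRadziwillTao2015, Theorem 1.6], logarithmic averaging in `n` for `k = 2` (tree `Literature.NumberTheory.LFunctions.tao_log_averaged_elliott_two`, `Literature.NumberTheory.LFunctions.tao_log_chowla_two`) [cite: TaoFMP2016, Theorem 1.3 and Corollary 1.5], and the binary unweighted Elliott conjecture at almost all scales [cite: TaoTeravainen2019AlmostAllScales, Corollary 1.13]; (d) AUDIT: weaken the CONCLUSION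 instead of strengthening the hypothesis — under the ORIGINAL hypothesis (1.6) on `f₁` the two-point correlation `(1/x)∑_{n ≤ x} f₁(n+h₁)f₂(n+h₂)` tends to `0` along a set of scales of full upper logarithmic density (named fact `KlurmanMangerelTeravainen2023_twoPoint` of `ElliottOriginalFormNarrow.lean`; "settles the two-point case of Problem 7.3 of the 2018 AIM conference … asks if the non-pretentiousness of `f` is enough for the two-point correlations of `f` and `f̄` to tend to `0` along a subsequence", the qualitative version being also due to Frantzikinakis–Lemańczyk–de la Rue) [cite: KlurmanMangerelTeravainen2023, Theorem 1.2], for all orders this is KMT's "modified Elliott conjecture" 2.10 ("another possible way to correct Elliott's conjecture without strengthening the hypothesis on `f₁`"), IMPLIED by Tao's corrected asymptotic conjecture 2.12 ("Thus, if Conjecture 2.12 holds, then Elliott's original conjecture holds at almost all scales") [cite: KlurmanMangerelTeravainen2023, §2.5 (Conjecture 2.10, Proposition 2.13)], and for the MRT class itself "the Chowla conjecture holds along a subsequence" (the Bernoulli shift is a Furstenberg system; "all MRT functions satisfy the Sarnak and the Chowla–Elliott conjecture along some subsequence") [cite: GomilkoLemanczykDelarue2021, Abstract and Main Theorem] [cite: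 FrantzikinakisLemanczykDelarue2025, §2.3 (before Theorem 2.15)]; (e) AUDIT: windows in `t` — for `1`-bounded `g`, `inf_{|t| ≤ x^c} 𝔻(g, χ(n)n^{it}; x)² → ∞` (each `χ`) is EQUIVALENT to (1.8) for every fixed `c > 0` (`ElliottWindow.isNonpretentious_iff_powWindow`, proved: raising the height from `x` to `x^a` costs `≤ 2 log a + o(1)` in `𝔻²`), so Tao's window `|t| ≤ A x^{k−1}` and MRT's `|t| ≤ X` are one asymptotic hypothesis, while (1.6) is EQUIVALENT to uniformity on every BOUNDED window `|t| ≤ A` (`ElliottWindow.isPointwiseNonpretentious_iff_boundedWindow`, proved, Dini); only growing sub-power windows `|t| ≤ ψ(x)`, `ψ(x) = x^{o(1)} → ∞`, lie strictly between the refuted and the corrected hypothesis, and nothing is printed about them [cite: KlurmanMangerelTeravainen2023, Conjecture 2.12 and Lemma 5.3].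
scope_caveats: the counterexample is complex-valued (`g(p)` on the unit circle) and multiplicative but not completely multiplicative; the completely multiplicative variant is asserted with details "left to the interested reader", and nothing is claimed for real-valued functions, for `λ`, `μ`, or for `Λ`-correlations (Hardy–Littlewood) themselves [cite: MatomakiRadziwillTao2015, Appendix B (last paragraph) and §1.1]; the lower bound `|∑_{n ≤ t_m} g(n)ḡ(n+1)| ≫ t_m` is printed only along the constructed sequence `t_m → ∞`, not for all large `X` [cite: MatomakiRadziwillTao2015, Theorem B.1]; the failure of the log-averaged conclusion under (1.6) is stated as "not difficult to adapt", without proof [cite: TaoFMP2016, Remark 1.6]; AUDIT: the record (and the tree's proof, `MatomakiRadziwillTao2015_counterexample_holds`) asserts largeness only EVENTUALLY ALONG the constructed `T m → ∞` — the all-large-`X` strengthening is false modulo KMT's Theorem 1.2 (`not_counterexample_allScales` in `ElliottOriginalFormNarrow.lean`: every pointwise non-pretentious `g` has `lim inf_X |∑_{n ≤ X} g(n)ḡ(n+1)|/X = 0`), i.e. the obstruction is to the `lim sup` [cite: KlurmanMangerelTeravainen2023, Theorem 1.2]; the pretender frequency at scale `X = t_{m+1}` is `s_{m+1} = X^{1/2}`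 in print (`t_{m+1} := s_{m+1}²`) and `≤ X/60000` in the tree's construction, so no particular growing window `|t| ≤ ψ(X)` with `ψ → ∞` is shown insufficient by the record as stated [cite: MatomakiRadziwillTao2015, Appendix B (proof of Theorem B.1)].
status: established — PROVED in the tree (`MatomakiRadziwillTao2015_counterexample_holds`, file `ElliottOriginalFormProofs.lean`); NARROWED by the 2026-08-16 audit (file `ElliottOriginalFormNarrow.lean`: evasion fact `KlurmanMangerelTeravainen2023_twoPoint`, proved `not_counterexample_allScales`, `ElliottWindow.isNonpretentious_iff_powWindow`, `ElliottWindow.isPointwiseNonpretentious_iff_boundedWindow`) [cite: KlurmanMangerelTeravainen2023, Theorem 1.2 and Proposition 1.3] -/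
def MatomakiRadziwillTao2015_counterexample : Prop :=
  ∃ g : ArithmeticFunction ℂ, g.IsMultiplicative ∧ (∀ n, ‖g n‖ ≤ 1) ∧
    IsPointwiseNonpretentious g ∧
    ∃ (T : ℕ → ℕ) (c : ℝ), Tendsto T atTop atTop ∧ 0 < c ∧
      ∀ᶠ m in atTop, c * (T m : ℝ) ≤ ‖∑ n ∈ Icc 1 (T m), g n * conj (g (n + 1))‖

/-! ## Proved consequences -/

/-- The corrected (MRT (1.8), tree `Literature.NumberTheory.Sieve.IsNonpretentious`) hypothesis implies Elliott's original
one for `1`-bounded `g`: `inf_{|t'| ≤ x} 𝔻(g, χ(n)n^{it'}; x)² ≤ 𝔻(g, χ(n)n^{it}; x)²` as soon as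
`x ≥ |t|`. Hence `ElliottConjectureOriginal` has the WEAKER hypothesis and is the STRONGER
conjecture. [cite: MatomakiRadziwillTao2015, §1.1 ((1.6) versus (1.8))] -/
theorem IsNonpretentious.isPointwiseNonpretentious {g : ℕ → ℂ} (hg : ∀ n, ‖g n‖ ≤ 1)
    (h : Literature.NumberTheory.Sieve.IsNonpretentious g) : IsPointwiseNonpretentious g := by
  intro q _ χ t
  refine tendsto_atTop_mono' atTop ?_ (h q χ)
  filter_upwards [eventually_ge_atTop |t|] with x hx
  have ht : t ∈ Set.Icc (-x) x := ⟨by linarith [neg_abs_le t], le_trans (le_abs_self t) hx⟩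
  unfold Literature.NumberTheory.Sieve.charNonpretentiousness
  refine ciInf_le ⟨0, ?_⟩ (⟨t, ht⟩ : Set.Icc (-x) x)
  rintro _ ⟨t', rfl⟩
  exact Literature.NumberTheory.Sieve.pretentiousDistSq_nonneg hg (Literature.NumberTheory.Sieve.norm_twistedChar_le_one χ _) x

-- names the `@[deprecated]` tombstone `ElliottConjectureOriginal` on purpose: it records that the refuted ORIGINAL
-- form is the formally STRONGER statement, so Theorem B.1 leaves the corrected `ElliottConjectureMRT` untouched
-- (verdict clean-up 2026-08-16); REMOVE-WHEN the tombstone is deleted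
set_option linter.deprecated false in
/-- `ElliottConjectureOriginal` implies the corrected tree statement `Literature.NumberTheory.LFunctions.ElliottConjectureMRT`
(shifts `n + h_j` are the forms `1·n + h_j`; distinct shifts are pairwise independent pairs
`(1, h_i), (1, h_j)`; the corrected hypothesis implies the original one).
[cite: MatomakiRadziwillTao2015, §1.1 and Conjecture 1.5] -/
theorem ElliottConjectureOriginal.elliottConjectureMRT (h : ElliottConjectureOriginal) :
    Literature.NumberTheory.LFunctions.ElliottConjectureMRT := by
  intro k g sh hmult hbd hinj hnp
  obtain ⟨j₀, hj₀⟩ := hnp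
  have key := h k g (fun _ => 1) sh hmult hbd (fun _ => le_rfl)
    (fun i j hij => by simpa using fun h' => hij (hinj h'.symm))
    ⟨j₀, IsNonpretentious.isPointwiseNonpretentious (hbd j₀) hj₀⟩
  simpa using key

/-- The complex conjugate of an arithmetic function. [folklore] -/
def conjFun (g : ArithmeticFunction ℂ) : ArithmeticFunction ℂ :=
  ⟨fun n => conj (g n), by simp⟩

/-- `conjFun g n = conj (g n)`. [folklore] -/
@[simp] theorem conjFun_apply (g : ArithmeticFunction ℂ) (n : ℕ) : conjFun g n = conj (g n) :=
  rfl

/-- Conjugation preserves multiplicativity. [folklore] -/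
theorem isMultiplicative_conjFun {g : ArithmeticFunction ℂ} (hg : g.IsMultiplicative) :
    (conjFun g).IsMultiplicative := by
  refine ⟨by simp [hg.map_one], fun {m n} hmn => ?_⟩
  simp [hg.map_mul_of_coprime hmn]

-- names the `@[deprecated]` tombstone `ElliottConjectureOriginal` on purpose: this IS its refutation modulo the
-- (proved) fact `MatomakiRadziwillTao2015_counterexample`, used by `ElliottConjectureOriginal_false`
-- (verdict clean-up 2026-08-16); REMOVE-WHEN the tombstone is deleted
set_option linter.deprecated false in
/-- **Theorem B.1 refutes Elliott's conjecture in its original form**: take `k = 2`,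
`g₁ = g`, `g₂ = ḡ`, `(a₁, b₁) = (1, 0)`, `(a₂, b₂) = (1, 1)`; the conclusion
`∑_{n ≤ X} g(n)ḡ(n+1) = o(X)` contradicts `|∑_{n ≤ t_m} g(n)ḡ(n+1)| ≫ t_m` along `t_m → ∞`.
Unconditional form: `ElliottConjectureOriginal_false` (`ElliottOriginalFormProofs.lean`).
[cite: MatomakiRadziwillTao2015, Appendix B, Theorem B.1 and §1.1] -/
theorem MatomakiRadziwillTao2015_counterexample.not_elliottConjectureOriginal
    (h : MatomakiRadziwillTao2015_counterexample) : ¬ ElliottConjectureOriginal := by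
  intro hE
  obtain ⟨g, hmult, hbd, hnp, T, c, hT, hc, hlow⟩ := h
  -- the instance of the conjecture
  let G : Fin 2 → ArithmeticFunction ℂ := ![g, conjFun g]
  let a : Fin 2 → ℕ := ![1, 1]
  let b : Fin 2 → ℕ := ![0, 1]
  have hGm : ∀ j, (G j).IsMultiplicative := by
    intro j; fin_cases j
    · simpa [G] using hmult
    · simpa [G] using isMultiplicative_conjFun hmult
  have hGb : ∀ j n, ‖G j n‖ ≤ 1 := by
    intro j n; fin_cases j
    · simpa [G] using hbd n
    · simpa [G] using hbd n
  have ha : ∀ j, 1 ≤ a j := by intro j; fin_cases j <;> simp [a]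
  have hab : ∀ i j, i ≠ j → a i * b j ≠ a j * b i := by
    intro i j hij; fin_cases i <;> fin_cases j <;> simp_all [a, b]
  have hex : ∃ j, IsPointwiseNonpretentious (G j) := ⟨0, by simpa [G] using hnp⟩
  have hlo := hE 2 G a b hGm hGb ha hab hex
  have hprod : ∀ n : ℕ, ∏ j, G j (a j * n + b j) = g n * conj (g (n + 1)) := by
    intro n
    simp [G, a, b, Fin.prod_univ_two]
  simp_rw [hprod] at hlo
  -- little-o gives eventually `‖S X‖ ≤ (c/2) X`
  have hev : ∀ᶠ X : ℕ in atTop,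
      ‖∑ n ∈ Icc 1 X, g n * conj (g (n + 1))‖ ≤ c / 2 * (X : ℝ) := by
    have := hlo.def (half_pos hc)
    filter_upwards [this] with X hX
    simpa [Complex.norm_natCast] using hX
  -- pull back along `T → ∞`
  have hev' := hT.eventually hev
  obtain ⟨m, hm₁, hm₂, hm₃⟩ := (hlow.and (hev'.and (hT.eventually (eventually_ge_atTop 1)))).exists
  have h1 : c * (T m : ℝ) ≤ c / 2 * (T m : ℝ) := le_trans hm₁ hm₂
  have hTpos : (0 : ℝ) < T m := by exact_mod_cast hm₃
  nlinarith

end Literature.Barriers.Parity
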